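import Literature.Computability.Cryptography.QubitRegister
import Literature.Computability.Cryptography.QuantumCircuit
import Literature.Computability.Cryptography.ClassBQP
import Literature.Computability.Complexity.ProbabilisticClasses
import HarnessLib

/-!
# Barrier catalogue `QuantumAdvantage` — bounded multipartite entanglement (Jozsa–Linden)

Topic `Literature/Barriers/QuantumAdvantage` (D-0021). Summit statement:
`QuantumAdvantage := ∃ L, L ∈ BQP ∧ L ∉ BPP`.

BARRIER: technique_class := witnessing the summit with (pure-state) quantum algorithms whose
  states never carry multipartite entanglement across more than a bounded number `p` of qubits —
  every intermediate state is `p`-blocked, i.e. a product of states of blocks of `≤ p` qubits;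
  this covers algorithms using only bipartite entanglement (even if every pair of qubits becomes
  entangled at some stage) and distributed quantum computing on pure states with local processors
  of `≤ p` qubits and classical communication [cite: JozsaLinden2003, §3 (discussion after the theorem labelled pblthm)];
  blocks := any exponential quantum/classical separation, in particular any witness
  `L ∈ BQP \ BPP`, obtained from such a family: it decides only languages in `BPP`
  (`jozsaLinden2003_pblocked`) — "multi-partite entanglement with unboundedly many qubits entangled
  together, is a necessary feature of any quantum algorithm (operating on pure states) if the
  algorithm is to exhibit an exponential speed-up over classical computation"
  [cite: JozsaLinden2003, (abstract) and §3 (theorem pblthm)];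
  because := a `p`-blocked pure state of `m` qubits has an exact `poly(m)`-size description
  (block labels and at most `2^{p+1}` real amplitudes per block) which is updated gate by gate
  with a bounded number of arithmetic operations, re-blocking after each two-qubit gate (lemma
  `ratpbl`, rational gates); for general finite gate sets the rationality requirement is lifted by
  rational approximation plus a "transmogrification" of the perturbed states back to `p`-blocked
  ones (theorem `pblthm`), giving a classical simulation to any tolerance `η` in `poly(n, log 1/η)`,
  hence a `BPP` algorithm for a decision problem [cite: JozsaLinden2003, §2 (finite tolerance suffices for BPP) and §3 (lemma ratpbl, theorem pblthm and its proof)];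
  evasions_known := unboundedly growing multipartite entanglement (explicitly present in Shor's
  algorithm) [cite: JozsaLinden2003, §4]; the theorem does not apply to mixed-state computations —
  a separable mixed state need not be `p`-blocked, and "an exponential computational speed-up
  might be possible with mixed states in the total absence of entanglement" is left open
  [cite: JozsaLinden2003, (abstract) and §5]; conversely entanglement is necessary but not
  sufficient: stabiliser computations are highly entangled yet classically simulable
  (Gottesman–Knill), as are Valiant's matchgate circuits [cite: JozsaLinden2003, §6];
  status := theorem.

## Contents

* `IsProductAcross blk ψ`, `IsPBlocked p ψ` — Jozsa–Linden's `p`-blocked pure states of a register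
  `QReg N → ℂ` (a partition of the wires into blocks of size `≤ p` across which `ψ` factorises).
* `QCircuitFamily.HasPBlockedStates p F` — every intermediate state of the family, on every
  classical input `|x⟩|0…0⟩`, is `p`-blocked (states after each prefix of the gate list; deliberate
  dot-notation extension of Q2's `Literature.Computability.Cryptography.QCircuitFamily`).
* `jozsaLinden2003_pblocked` — the `p`-blocked simulation theorem of §3 (arXiv label `pblthm`)
  read for the tree's poly-time uniform Clifford+T families (a finite set of gates on `≤ 2`
  qubits, the paper's model of §2) with the paper's own decision consequence (`BPP`).

## Design notes

* Jozsa–Linden's computational model (§2: a fixed finite set of 2-qubit gates; for each `n` a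
  gate list output by a classical algorithm in `poly` time; run on `|i₁…iₙ⟩|0…0⟩`; measure the
  leftmost qubit) is exactly Q2's uniform `QCircuitFamily` measured on wire `0`; Clifford+T's
  one-qubit gates count as 2-qubit gates acting trivially on a second qubit.
* "Classically efficiently simulated" is the sampling notion of §2; the paper notes (§2, before
  §3) that for a bounded-error decision algorithm a finite tolerance `η₀ < 1/6` already yields a
  `BPP` algorithm, which is the consequence typed here (weaker than `P`, deliberately).
* Numbering: the arXiv source (quant-ph/0201143) carries labels, not numbers, in the extracted
  text; the result vendored is the first theorem of §3 (label `pblthm`), preceded by the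
  rational-gate lemma (label `ratpbl`); we cite by section and label.
* Mathlib/tree: no `Schmidt`, `productState`, `blocked` (`lean search`); tensor-product structure
  on `QReg N = Fin N → Bool` is expressed pointwise (`ψ x = ∏ₖ φₖ x` with `φₖ` depending only on
  the wires of block `k`).

## References

* [JozsaLinden2003] R. Jozsa, N. Linden, *On the role of entanglement in quantum-computational
  speed-up*, Proc. R. Soc. Lond. A 459 (2003) 2011–2032 (arXiv:quant-ph/0201143): abstract, §2,
  §3 (lemma `ratpbl`, theorem `pblthm` and discussion), §4, §5, §6. Read via
  `lit read paper:arxiv-quant-ph_0201143`.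
-/

noncomputable section

open Computability Literature.Computability.Complexity

namespace Literature.Barriers.QuantumAdvantage

variable {G : Literature.Computability.Cryptography.QGateSet}

/-! ### `p`-blocked pure states (Jozsa–Linden §3) -/

/-- `IsProductAcross blk ψ`: the register state `ψ` factorises across the labelling `blk` of the
wires by block indices — `ψ(x) = ∏ₖ φₖ(x)` over the occurring blocks `k`, where each factor `φₖ`
depends only on the wires labelled `k` ("`ρ = ρ₁ ⊗ ρ₂ ⊗ ⋯ ⊗ ρ_K` where `ρᵢ` is a state of the
qubits in `Bᵢ` only", pure case). [cite: JozsaLinden2003, §3 (definition of p-blocked)] -/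
def IsProductAcross {N : ℕ} (blk : Fin N → ℕ) (ψ : Literature.Computability.Cryptography.QReg N → ℂ) : Prop :=
  ∃ φ : ℕ → Literature.Computability.Cryptography.QReg N → ℂ,
    (∀ (k : ℕ) (x y : Literature.Computability.Cryptography.QReg N), (∀ i, blk i = k → x i = y i) → φ k x = φ k y) ∧
    ∀ x : Literature.Computability.Cryptography.QReg N, ψ x = ∏ k ∈ Finset.univ.image blk, φ k x

/-- `IsPBlocked p ψ`: the pure state `ψ` of `N` qubits is **`p`-blocked** — the wires can be
partitioned into blocks of size at most `p` across which `ψ` is a product state ("a pure state is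
`p`-blocked if and only if no `p+1` qubits are all entangled together").
[cite: JozsaLinden2003, §3 (definition of p-blocked)] -/
def IsPBlocked {N : ℕ} (p : ℕ) (ψ : Literature.Computability.Cryptography.QReg N → ℂ) : Prop :=
  ∃ blk : Fin N → ℕ, (∀ k, (Finset.univ.filter fun i => blk i = k).card ≤ p) ∧
    IsProductAcross blk ψ

/-- Every state on `N ≥ 1` wires is `N`-blocked (one block containing all wires; for `N = 0`
the empty product forces the scalar `1`, a harmless junk case). [cite: JozsaLinden2003, §3] -/
theorem isPBlocked_self {N : ℕ} (hN : 0 < N) (ψ : Literature.Computability.Cryptography.QReg N → ℂ) : IsPBlocked N ψ := by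
  classical
  refine ⟨fun _ => 0, fun k => (Finset.card_filter_le _ _).trans (by simp),
    fun k => if k = 0 then ψ else fun _ => 1, fun k x y hxy => ?_, fun x => ?_⟩
  · by_cases hk : k = 0
    · subst hk
      have hfun : x = y := funext fun i => hxy i rfl
      simp [hfun]
    · simp [hk]
  · have himg : (Finset.univ.image fun _ : Fin N => (0 : ℕ)) = {0} := by
      ext k
      simp only [Finset.mem_image, Finset.mem_univ, true_and, Finset.mem_singleton]
      exact ⟨fun ⟨_, h⟩ => h.symm, fun h => ⟨⟨0, hN⟩, h.symm⟩⟩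
    simp [himg]

/-- `p`-blockedness is monotone in `p`. [cite: JozsaLinden2003, §3] -/
theorem IsPBlocked.mono {N p q : ℕ} {ψ : Literature.Computability.Cryptography.QReg N → ℂ} (h : IsPBlocked p ψ) (hpq : p ≤ q) :
    IsPBlocked q ψ := by
  obtain ⟨blk, hcard, hprod⟩ := h
  exact ⟨blk, fun k => (hcard k).trans hpq, hprod⟩

/-! ### Families with `p`-blocked states, and the simulation theorem -/

/-- The state of the family `F` on classical input `x` after the first `j` gates of its circuit:
`U_{g_j} ⋯ U_{g_1} |x⟩|0…0⟩` (empty oracle; `j` beyond the size gives the final state).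
Deliberate dot-notation extension of `Literature.Computability.Cryptography.QCircuitFamily`.
[cite: JozsaLinden2003, §3 ("the state after j steps of computation")] -/
def _root_.Literature.Computability.Cryptography.QCircuitFamily.stateAfter (F : Literature.Computability.Cryptography.QCircuitFamily G) (x : List Bool) (j : ℕ) :
    Literature.Computability.Cryptography.QReg (x.length + F.ancillas x.length) → ℂ :=
  Literature.Computability.Cryptography.QCircuit.runOn 0 ⟨((F.circ x.length).gates.take j)⟩ (Literature.Computability.Cryptography.basisState (Literature.Computability.Cryptography.padInput x.get (F.ancillas x.length)))

/-- `F.HasPBlockedStates p`: on every input and at every stage `j` the state of the computation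
is `p`-blocked (the hypothesis of Jozsa–Linden's theorem `pblthm`). Deliberate dot-notation
extension of `Literature.Computability.Cryptography.QCircuitFamily`. [cite: JozsaLinden2003, §3 (theorem pblthm, hypothesis)] -/
def _root_.Literature.Computability.Cryptography.QCircuitFamily.HasPBlockedStates (p : ℕ) (F : Literature.Computability.Cryptography.QCircuitFamily G) : Prop :=
  ∀ (x : List Bool) (j : ℕ), IsPBlocked p (F.stateAfter x j)

end Literature.Barriers.QuantumAdvantage

namespace Literature.Barriers.QuantumAdvantage

open Literature.Computability.Cryptography

/-- **Jozsa–Linden 2003, §3, theorem `pblthm`**: "Let `𝒢` be a finite set of 2-qubit gates and `p` a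
fixed positive integer. Suppose that `{𝒜ₙ}`, using gates from `𝒢`, is a polynomial time quantum
computation with the property that at each stage `j = 1, …, poly(n)` the state `|αⱼ⟩` is
`p`-blocked. Then the quantum computation can be classically efficiently simulated." With the
paper's remark that a finite-tolerance simulation of a bounded-error decision algorithm gives a
`BPP` algorithm (§2): a language decided with error `≤ 1/3` by a poly-time uniform, polynomial-size,
oracle-free Clifford+T family all of whose intermediate states are `p`-blocked lies in `BPP`.
[cite: JozsaLinden2003, §3 (theorem pblthm), with §2] -/
def jozsaLinden2003_pblocked : Prop :=
  ∀ (p : ℕ) (F : QCircuitFamily cliffordT) (L : Language Bool),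
    F.IsOracleFree → F.IsUniform → F.IsPolySize → F.HasPBlockedStates p →
    (∀ x, (x ∈ L → 2 / 3 ≤ F.acceptProbOn 0 x) ∧ (x ∉ L → F.acceptProbOn 0 x ≤ 1 / 3)) →
    L ∈ BPP

end Literature.Barriers.QuantumAdvantage

end
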